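import Summits.Parity.GeneralizedHardyLittlewood.Theorems.TableChowla.Negative.TableChowlaDegenerateWindows
import Summits.Parity.GeneralizedHardyLittlewood.Theorems.TableChowla.Negative.TableChowlaExceptionalSet

/-!
# Line `helson-kronecker-inverse` (crux `TableChowla`, stmt-Parity-14270): load-bearing hypotheses
# of its registered stubs

Negative lemmas (drefute seat) for the stub set of the picked line
`Cruxes/TableChowla/Lines/helson-kronecker-inverse.lean` (lead reshape r1: `stub_inverse` = `InverseCM`,
`stub_bv`, `stub_periodic_of_bv`, `stub_aperiodic` = `MeanSquareCMAperiodic`). The stub statements are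
restated textually inside the theorems (a `Theorems/` file may not import the crux work file; no new
definition is introduced), with the table entry written `lam (Int.toNat (a*b+c))`, `lam n = (λ n : ℝ)`
(definitionally the stubs' `((λ ·) : ℝ)`), and with ONE hypothesis deleted each time.

* `not_meanSquareCMAperiodicWithoutShiftNeZero` — `c ≠ 0` is LOAD-BEARING in `stub_aperiodic`: at
  `c = 0` the weight `g = λ` (completely multiplicative, 1-bounded, and aperiodic for every period
  `q ≥ 1` because `λ(2q) = −λ(q)`) has `∑_{b ≤ y} λ(b) λ(ab) = λ(a)·⌊y⌋`, so the mean square over the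
  rows is `rows · ⌊y⌋²` — no cancellation (`x = m¹²`, `A = m`, `y = m¹¹`: `m²³ > m²³/(12 log m)`).
* `not_meanSquareCMPeriodicWithoutUpperWindow`, `not_meanSquareCMAperiodicWithoutUpperWindow` — the
  upper window bound `A ≤ x^{1/3+δ}` is LOAD-BEARING in both residual stubs: the ONE-COLUMN table
  `A = x`, `y = 1`, with `g ≡ 1` (CM, `1`-periodic) resp. `g = 𝟙_{n = 1}` (CM, aperiodic), has mean
  square `rows = N > N / log N`.
* `sub_one_le_card_rows`, `window_lower` — window bookkeeping from below (`rows ≥ A − 1`; beyond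
  `max(e⁸, 2^{1/δ})`: `A ≥ 2`, `x/A ≥ 2`, `log x ≥ 8`), used by the companion file
  `HelsonLeverCalibration.lean` (the lever `InverseCM` calibrated at `c = 0` — holds, non-vacuously,
  witness `g = λ` — and the CM-free lever proved by delocalisation).
[folklore]
-/

namespace Summit.Parity.GeneralizedHardyLittlewood.Theorems.TableChowla.Negative

open Finset Real ArithmeticFunction
open Summit.Parity.GeneralizedHardyLittlewood.Theses

noncomputable section

/-! ## `λ` and `𝟙_{n=1}` as complex weights -/

/-- Complete multiplicativity of `λ`, read in `ℂ`. -/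
theorem lamC_mul (m n : ℕ) : ((lam (m * n) : ℝ) : ℂ) = (lam m : ℂ) * (lam n : ℂ) := by
  rw [lam_mul]; push_cast; ring

/-- `‖λ(n)‖ ≤ 1` in `ℂ`. -/
theorem norm_lamC_le_one (n : ℕ) : ‖((lam n : ℝ) : ℂ)‖ ≤ 1 := by
  rw [Complex.norm_real, Real.norm_eq_abs]; exact abs_lam_le_one n

/-- `λ(2) = −1`. -/
theorem lam_two : lam 2 = -1 := by
  unfold lam
  rw [liouville_apply two_ne_zero, cardFactors_apply_prime Nat.prime_two]
  norm_num

/-- `λ(n) ≠ 0` for `n ≥ 1`. -/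
theorem lam_ne_zero {n : ℕ} (hn : n ≠ 0) : lam n ≠ 0 := by
  unfold lam; exact_mod_cast liouville_ne_zero hn

/-- `λ` has NO period `q ≥ 1`: `λ(q + q) = λ(2q) = −λ(q) ≠ λ(q)`. -/
theorem not_periodic_lamC {q : ℕ} (hq : 1 ≤ q) : ¬ Function.Periodic (fun n : ℕ => ((lam n : ℝ) : ℂ)) q := by
  intro h
  have h1 : ((lam (q + q) : ℝ) : ℂ) = (lam q : ℂ) := h q
  have hq0 : q ≠ 0 := by omega
  have h2 : ((lam (q + q) : ℝ) : ℂ) = -(lam q : ℂ) := by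
    rw [← two_mul, lamC_mul, lam_two]; push_cast; ring
  rw [h2] at h1
  have h3 : ((lam q : ℝ) : ℂ) = 0 := by
    have : (2 : ℂ) * (lam q : ℂ) = 0 := by linear_combination -h1
    simpa using this
  exact lam_ne_zero hq0 (by exact_mod_cast h3)

/-- `𝟙_{n=1}` is completely multiplicative (`mn = 1 ↔ m = n = 1`). -/
theorem delta1_mul (m n : ℕ) :
    (if m * n = 1 then (1 : ℂ) else 0) = (if m = 1 then (1 : ℂ) else 0) * (if n = 1 then (1 : ℂ) else 0) := by
  by_cases hm : m = 1 <;> by_cases hn : n = 1 <;> simp [hm, hn]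

/-- `𝟙_{n=1}` is 1-bounded. -/
theorem norm_delta1_le_one (n : ℕ) : ‖(if n = 1 then (1 : ℂ) else 0)‖ ≤ 1 := by
  split_ifs <;> simp

/-- `𝟙_{n=1}` has no period `q ≥ 1` (`𝟙(1+q) = 0 ≠ 1 = 𝟙(1)`). -/
theorem not_periodic_delta1 {q : ℕ} (hq : 1 ≤ q) :
    ¬ Function.Periodic (fun n : ℕ => if n = 1 then (1 : ℂ) else 0) q := by
  intro h
  have h1 : (if 1 + q = 1 then (1 : ℂ) else 0) = (if (1 : ℕ) = 1 then (1 : ℂ) else 0) := h 1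
  simp at h1
  omega

/-! ## The rank-one instance `c = 0` against the weight `g = λ` -/

/-- At `c = 0` the table entry is `λ(ab)`. -/
theorem entry_shift_zero (a b : ℕ) : lam (Int.toNat ((a : ℤ) * b + 0)) = lam (a * b) := by
  rw [add_zero, show ((a : ℤ) * (b : ℕ)) = ((a * b : ℕ) : ℤ) by push_cast; rfl, Int.toNat_natCast]

/-- `∑_{b ≤ B} λ(b) λ(ab) = λ(a) · B` (`λ(b)² = 1`). -/
theorem sum_lamC_mul_entry_shift_zero (a B : ℕ) :
    ∑ b ∈ Icc 1 B, ((lam b : ℝ) : ℂ) * (lam (Int.toNat ((a : ℤ) * b + 0)) : ℂ) = (lam a : ℂ) * B := by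
  have h : ∀ b ∈ Icc 1 B, ((lam b : ℝ) : ℂ) * (lam (Int.toNat ((a : ℤ) * b + 0)) : ℂ) = (lam a : ℂ) := by
    intro b hb
    have hb0 : b ≠ 0 := by simp only [mem_Icc] at hb; omega
    have hsq : lam b * lam b = 1 := by rw [← sq]; exact lam_sq hb0
    rw [entry_shift_zero, lam_mul]
    calc (lam b : ℂ) * ((lam a * lam b : ℝ) : ℂ) = (lam a : ℂ) * ((lam b * lam b : ℝ) : ℂ) := by
          push_cast; ring
      _ = (lam a : ℂ) := by rw [hsq]; push_cast; ring
  rw [sum_congr rfl h, sum_const, Nat.card_Icc, Nat.add_sub_cancel, nsmul_eq_mul, mul_comm]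

/-- Hence the `c = 0` mean square of the weight `λ` over rows `⊆ [1, ∞)` is `rows · B²` exactly. -/
theorem meanSquare_lamC_shift_zero (A₁ A₂ B : ℕ) :
    ∑ a ∈ Ioc A₁ A₂, ‖∑ b ∈ Icc 1 B, ((lam b : ℝ) : ℂ) * (lam (Int.toNat ((a : ℤ) * b + 0)) : ℂ)‖ ^ 2 =
      ((Ioc A₁ A₂).card : ℝ) * (B : ℝ) ^ 2 := by
  have h : ∀ a ∈ Ioc A₁ A₂,
      ‖∑ b ∈ Icc 1 B, ((lam b : ℝ) : ℂ) * (lam (Int.toNat ((a : ℤ) * b + 0)) : ℂ)‖ ^ 2 = (B : ℝ) ^ 2 := by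
    intro a ha
    have ha0 : a ≠ 0 := by simp only [mem_Ioc] at ha; omega
    rw [sum_lamC_mul_entry_shift_zero, norm_mul, mul_pow, Complex.norm_real, Real.norm_eq_abs, sq_abs,
      lam_sq ha0, one_mul, Complex.norm_natCast]
  rw [sum_congr rfl h, sum_const, nsmul_eq_mul]

/-! ## `c ≠ 0` is load-bearing in `stub_aperiodic` -/

/-- `c ≠ 0` is LOAD-BEARING for the aperiodic residual. The negated statement is `stub_aperiodic`'s
(`MeanSquareCMAperiodic` of the line file, entry via `lam`) with the hypothesis `c ≠ 0` DROPPED; it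
fails at `c = 0` for the aperiodic completely multiplicative weight `g = λ`
(`x = m¹²`, `A = m`, `y = m¹¹`, `C = 1`: `m · (m¹¹)² ≤ m²³/(12 log m)` is false). -/
theorem not_meanSquareCMAperiodicWithoutShiftNeZero :
    ¬ (∀ c : ℤ, ∀ δ : ℝ, 0 < δ → δ ≤ 1 / 12 → ∀ C : ℝ, 0 < C → ∃ K : ℝ, 0 < K ∧ ∃ x₀ : ℝ,
      ∀ x : ℝ, x₀ ≤ x → ∀ A : ℝ, x ^ δ ≤ A → A ≤ x ^ (1 / 3 + δ) →
      ∀ g : ℕ → ℂ, (∀ m n : ℕ, g (m * n) = g m * g n) → (∀ n : ℕ, ‖g n‖ ≤ 1) →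
      (∀ q : ℕ, 1 ≤ q → (q : ℝ) ≤ Real.log x ^ K → ¬ Function.Periodic g q) →
      ∀ y : ℝ, y ≤ x / A →
        ∑ a ∈ Ioc ⌊A⌋₊ ⌊2 * A⌋₊,
            ‖∑ b ∈ Icc 1 ⌊y⌋₊, g b * (lam (Int.toNat ((a : ℤ) * b + c)) : ℂ)‖ ^ 2 ≤
          x * (x / A) / Real.log x ^ C) := by
  intro h
  obtain ⟨K, -, x₀, hx₀⟩ := h 0 (1 / 12) (by norm_num) le_rfl 1 one_pos
  obtain ⟨m, hm⟩ := exists_nat_ge (max x₀ 2)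
  have hm2 : (2 : ℝ) ≤ m := le_trans (le_max_right _ _) hm
  have hmx : x₀ ≤ m := le_trans (le_max_left _ _) hm
  have hm1 : (1 : ℝ) ≤ m := by linarith
  have hm1' : 1 ≤ m := by exact_mod_cast hm1
  have hmpos : (0 : ℝ) < m := by linarith
  have hxx₀ : x₀ ≤ (m : ℝ) ^ 12 := hmx.trans (le_self_pow₀ hm1 (by norm_num))
  obtain ⟨hw1, hw2⟩ := window_pow (k := 12) (by norm_num) hm1'
  have hy : (m : ℝ) ^ 11 ≤ (m : ℝ) ^ 12 / m := by
    rw [le_div_iff₀ hmpos, ← pow_succ]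
  have key := hx₀ ((m : ℝ) ^ 12) hxx₀ m (by exact_mod_cast hw1) (by exact_mod_cast hw2)
    (fun n : ℕ => ((lam n : ℝ) : ℂ)) (fun m n => lamC_mul m n) norm_lamC_le_one
    (fun q hq _ => not_periodic_lamC hq) ((m : ℝ) ^ 11) hy
  rw [Nat.floor_natCast, floor_two_mul_natCast,
    show ((m : ℝ) ^ 11) = ((m ^ 11 : ℕ) : ℝ) by push_cast; rfl, Nat.floor_natCast,
    meanSquare_lamC_shift_zero, Nat.card_Ioc, show 2 * m - m = m by omega, Real.rpow_one,
    Real.log_pow] at key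
  -- key : m · (m¹¹)² ≤ m¹² · (m¹² / m) / (12 · log m)
  have hP : (0 : ℝ) < (m : ℝ) * ((m ^ 11 : ℕ) : ℝ) ^ 2 := by positivity
  refine absurd_of_le_div hP (κ := 1) (le_of_eq ?_) zero_le_one ?_ key
  · push_cast; field_simp
  · have := Real.log_le_log (by norm_num) hm2
    have := log_two_gt_half
    push_cast
    linarith

/-! ## The upper window bound is load-bearing in both residual stubs (one-column table) -/

/-- ONE-COLUMN mean square: for any weight with `g 1 = 1`, at `y = 1`, `c = 1`, rows `(N, 2N]`:
`∑_a ‖∑_{b ∈ [1,1]} g(b) λ(a·b+1)‖² = N` (every summand is `λ(a+1)² = 1`). -/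
theorem meanSquare_one_col {g : ℕ → ℂ} (hg : g 1 = 1) (N : ℕ) :
    ∑ a ∈ Ioc N (2 * N), ‖∑ b ∈ Icc 1 1, g b * (lam (Int.toNat ((a : ℤ) * b + 1)) : ℂ)‖ ^ 2 = N := by
  have h : ∀ a ∈ Ioc N (2 * N),
      ‖∑ b ∈ Icc 1 1, g b * (lam (Int.toNat ((a : ℤ) * b + 1)) : ℂ)‖ ^ 2 = 1 := by
    intro a _
    rw [Icc_self, sum_singleton, hg, one_mul, Nat.cast_one, mul_one,
      show ((a : ℤ) + 1) = ((a + 1 : ℕ) : ℤ) by push_cast; ring, Int.toNat_natCast,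
      Complex.norm_real, Real.norm_eq_abs, sq_abs, lam_sq (Nat.succ_ne_zero a)]
  rw [sum_congr rfl h, sum_const, Nat.card_Ioc, show 2 * N - N = N by omega, nsmul_eq_mul, mul_one]

/-- Shared contradiction: the one-column instance `x = A = N ≥ 3`, `y = 1`, `C = 1` of either residual
stub, for a weight with `g 1 = 1`. -/
theorem one_col_meanSquare_violates {g : ℕ → ℂ} (hg : g 1 = 1) {N : ℕ} (hN3 : (3 : ℝ) ≤ N) :
    ¬ (∑ a ∈ Ioc ⌊(N : ℝ)⌋₊ ⌊2 * (N : ℝ)⌋₊,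
          ‖∑ b ∈ Icc 1 ⌊(1 : ℝ)⌋₊, g b * (lam (Int.toNat ((a : ℤ) * b + 1)) : ℂ)‖ ^ 2 ≤
        (N : ℝ) * ((N : ℝ) / N) / Real.log N ^ (1 : ℝ)) := by
  intro key
  have hNpos : (0 : ℝ) < N := by linarith
  rw [Nat.floor_natCast, floor_two_mul_natCast, Nat.floor_one, meanSquare_one_col hg,
    Real.rpow_one] at key
  have hlog : 1 < Real.log N := one_lt_log_three.trans_le (Real.log_le_log (by norm_num) hN3)
  refine absurd_of_le_div hNpos (κ := 1) (le_of_eq ?_) zero_le_one hlog key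
  rw [div_self hNpos.ne', mul_one, one_mul]

/-- The upper window bound `A ≤ x ^ (1/3 + δ)` is LOAD-BEARING for `stub_periodic`: the negated
statement is `MeanSquareCMPeriodic` (entry via `lam`) with that bound DROPPED, and it fails on the
one-column table `A = x = N`, `y = 1`, weight `g ≡ 1` (completely multiplicative, period `q = 1`). -/
theorem not_meanSquareCMPeriodicWithoutUpperWindow :
    ¬ (∀ c : ℤ, c ≠ 0 → ∀ δ : ℝ, 0 < δ → δ ≤ 1 / 12 → ∀ C : ℝ, 0 < C → ∀ K : ℝ, 0 < K → ∃ x₀ : ℝ,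
      ∀ x : ℝ, x₀ ≤ x → ∀ A : ℝ, x ^ δ ≤ A →
      ∀ g : ℕ → ℂ, (∀ m n : ℕ, g (m * n) = g m * g n) → (∀ n : ℕ, ‖g n‖ ≤ 1) →
      ∀ q : ℕ, 1 ≤ q → (q : ℝ) ≤ Real.log x ^ K → Function.Periodic g q →
      ∀ y : ℝ, y ≤ x / A →
        ∑ a ∈ Ioc ⌊A⌋₊ ⌊2 * A⌋₊,
            ‖∑ b ∈ Icc 1 ⌊y⌋₊, g b * (lam (Int.toNat ((a : ℤ) * b + c)) : ℂ)‖ ^ 2 ≤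
          x * (x / A) / Real.log x ^ C) := by
  intro h
  obtain ⟨x₀, hx₀⟩ := h 1 one_ne_zero (1 / 12) (by norm_num) le_rfl 1 one_pos 1 one_pos
  obtain ⟨N, hN⟩ := exists_nat_ge (max x₀ 3)
  have hN3 : (3 : ℝ) ≤ N := le_trans (le_max_right _ _) hN
  have hNx : x₀ ≤ N := le_trans (le_max_left _ _) hN
  have hN1 : (1 : ℝ) ≤ N := by linarith
  have hNpos : (0 : ℝ) < N := by linarith
  have hwin : (N : ℝ) ^ ((1 : ℝ) / 12) ≤ N := by
    calc (N : ℝ) ^ ((1 : ℝ) / 12) ≤ (N : ℝ) ^ (1 : ℝ) :=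
          Real.rpow_le_rpow_of_exponent_le hN1 (by norm_num)
      _ = N := Real.rpow_one _
  have hlog : 1 < Real.log N := one_lt_log_three.trans_le (Real.log_le_log (by norm_num) hN3)
  have hq : ((1 : ℕ) : ℝ) ≤ Real.log N ^ (1 : ℝ) := by rw [Real.rpow_one]; push_cast; linarith
  have hy : (1 : ℝ) ≤ N / N := by rw [div_self hNpos.ne']
  exact one_col_meanSquare_violates rfl hN3
    (hx₀ N hNx N hwin (fun _ => (1 : ℂ)) (fun _ _ => by simp) (fun _ => by simp) 1 le_rfl hq
      (fun _ => rfl) 1 hy)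

/-- The upper window bound is LOAD-BEARING for `stub_aperiodic` as well: `MeanSquareCMAperiodic`
(entry via `lam`) with that bound DROPPED fails on the one-column table with the aperiodic completely
multiplicative weight `g = 𝟙_{n=1}`. -/
theorem not_meanSquareCMAperiodicWithoutUpperWindow :
    ¬ (∀ c : ℤ, c ≠ 0 → ∀ δ : ℝ, 0 < δ → δ ≤ 1 / 12 → ∀ C : ℝ, 0 < C → ∃ K : ℝ, 0 < K ∧ ∃ x₀ : ℝ,
      ∀ x : ℝ, x₀ ≤ x → ∀ A : ℝ, x ^ δ ≤ A →
      ∀ g : ℕ → ℂ, (∀ m n : ℕ, g (m * n) = g m * g n) → (∀ n : ℕ, ‖g n‖ ≤ 1) →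
      (∀ q : ℕ, 1 ≤ q → (q : ℝ) ≤ Real.log x ^ K → ¬ Function.Periodic g q) →
      ∀ y : ℝ, y ≤ x / A →
        ∑ a ∈ Ioc ⌊A⌋₊ ⌊2 * A⌋₊,
            ‖∑ b ∈ Icc 1 ⌊y⌋₊, g b * (lam (Int.toNat ((a : ℤ) * b + c)) : ℂ)‖ ^ 2 ≤
          x * (x / A) / Real.log x ^ C) := by
  intro h
  obtain ⟨K, -, x₀, hx₀⟩ := h 1 one_ne_zero (1 / 12) (by norm_num) le_rfl 1 one_pos
  obtain ⟨N, hN⟩ := exists_nat_ge (max x₀ 3)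
  have hN3 : (3 : ℝ) ≤ N := le_trans (le_max_right _ _) hN
  have hNx : x₀ ≤ N := le_trans (le_max_left _ _) hN
  have hN1 : (1 : ℝ) ≤ N := by linarith
  have hNpos : (0 : ℝ) < N := by linarith
  have hwin : (N : ℝ) ^ ((1 : ℝ) / 12) ≤ N := by
    calc (N : ℝ) ^ ((1 : ℝ) / 12) ≤ (N : ℝ) ^ (1 : ℝ) :=
          Real.rpow_le_rpow_of_exponent_le hN1 (by norm_num)
      _ = N := Real.rpow_one _
  have hy : (1 : ℝ) ≤ N / N := by rw [div_self hNpos.ne']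
  exact one_col_meanSquare_violates (g := fun n : ℕ => if n = 1 then (1 : ℂ) else 0) (by simp) hN3
    (hx₀ N hNx N hwin (fun n : ℕ => if n = 1 then (1 : ℂ) else 0) (fun m n => delta1_mul m n)
      norm_delta1_le_one (fun q hq _ => not_periodic_delta1 hq) 1 hy)

/-! ## Window bookkeeping from below (used by the companion calibration file) -/

/-- Rows lower bound: `A − 1 ≤ #(⌊A⌋, ⌊2A⌋]` (`A ≥ 0`). -/
theorem sub_one_le_card_rows {A : ℝ} (hA : 0 ≤ A) : A - 1 ≤ ((Ioc ⌊A⌋₊ ⌊2 * A⌋₊).card : ℝ) := by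
  rw [Nat.card_Ioc, Nat.cast_sub (Nat.floor_le_floor (by linarith : A ≤ 2 * A))]
  have h1 : 2 * A < (⌊2 * A⌋₊ : ℝ) + 1 := Nat.lt_floor_add_one _
  have h2 : (⌊A⌋₊ : ℝ) ≤ A := Nat.floor_le hA
  linarith

/-- Window bookkeeping from below: for `x ≥ max (e⁸) (2^{1/δ})` and `A` in the window,
`2 ≤ A`, `2 ≤ x/A` and `8 ≤ log x`. -/
theorem window_lower {δ x A : ℝ} (hδ : 0 < δ) (hδ' : δ ≤ 1 / 12)
    (hx : max (Real.exp 8) ((2 : ℝ) ^ (1 / δ)) ≤ x) (hA : x ^ δ ≤ A) (hA' : A ≤ x ^ (1 / 3 + δ)) :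
    2 ≤ A ∧ 2 ≤ x / A ∧ 8 ≤ Real.log x := by
  have hxe : Real.exp 8 ≤ x := le_trans (le_max_left _ _) hx
  have hx2 : (2 : ℝ) ^ (1 / δ) ≤ x := le_trans (le_max_right _ _) hx
  have hxpos : 0 < x := (Real.exp_pos 8).trans_le hxe
  have hlog : 8 ≤ Real.log x := (Real.le_log_iff_exp_le hxpos).mpr hxe
  have hx1 : (1 : ℝ) ≤ x := by
    have : (1 : ℝ) ≤ Real.exp 8 := Real.one_le_exp (by norm_num)
    linarith
  have hx4 : (4 : ℝ) ≤ x := by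
    have h16 : Real.log 4 ≤ 8 := by
      rw [show (4 : ℝ) = 2 ^ 2 by norm_num, Real.log_pow]
      have := Real.log_two_lt_d9
      push_cast; linarith
    calc (4 : ℝ) = Real.exp (Real.log 4) := (Real.exp_log (by norm_num)).symm
      _ ≤ Real.exp 8 := Real.exp_le_exp.mpr h16
      _ ≤ x := hxe
  -- `2 = (2^{1/δ})^δ ≤ x^δ ≤ A`
  have hA2 : 2 ≤ A := by
    have h : ((2 : ℝ) ^ (1 / δ)) ^ δ = 2 := by
      rw [← Real.rpow_mul (by norm_num), one_div_mul_cancel hδ.ne', Real.rpow_one]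
    calc (2 : ℝ) = ((2 : ℝ) ^ (1 / δ)) ^ δ := h.symm
      _ ≤ x ^ δ := Real.rpow_le_rpow (by positivity) hx2 hδ.le
      _ ≤ A := hA
  have hApos : 0 < A := by linarith
  -- `A ≤ x^{1/2}` and `x / x^{1/2} = x^{1/2} ≥ 2`
  have hAhalf : A ≤ x ^ (1 / 2 : ℝ) :=
    hA'.trans (Real.rpow_le_rpow_of_exponent_le hx1 (by linarith))
  have hhalf : x ^ (1 / 2 : ℝ) * x ^ (1 / 2 : ℝ) = x := by
    rw [← Real.rpow_add hxpos]; norm_num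
  have hsqrt2 : (2 : ℝ) ≤ x ^ (1 / 2 : ℝ) := by
    have h4 : (4 : ℝ) ^ (1 / 2 : ℝ) = 2 := by
      rw [show (4 : ℝ) = (2 : ℝ) ^ (2 : ℕ) by norm_num, ← Real.rpow_natCast,
        ← Real.rpow_mul (by norm_num)]
      norm_num
    calc (2 : ℝ) = (4 : ℝ) ^ (1 / 2 : ℝ) := h4.symm
      _ ≤ x ^ (1 / 2 : ℝ) := Real.rpow_le_rpow (by norm_num) hx4 (by norm_num)
  have hhalfpos : 0 < x ^ (1 / 2 : ℝ) := Real.rpow_pos_of_pos hxpos _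
  have hxA : 2 ≤ x / A := by
    calc (2 : ℝ) ≤ x ^ (1 / 2 : ℝ) := hsqrt2
      _ = x / x ^ (1 / 2 : ℝ) := by rw [eq_div_iff hhalfpos.ne', hhalf]
      _ ≤ x / A := div_le_div_of_nonneg_left hxpos.le hApos hAhalf
  exact ⟨hA2, hxA, hlog⟩

end

end Summit.Parity.GeneralizedHardyLittlewood.Theorems.TableChowla.Negative
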